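import Literature.InformationTheory.QuantumCodes.ToricCodeThreshold
import Literature.InformationTheory.QuantumCodes.CodeCapacityNoise
import Literature.Probability.RandomPlanarGeometry.BDGS2012
import Mathlib.Analysis.SpecificLimits.Basic
import HarnessLib

/-!
# The toric code with NOISY syndrome measurement (phenomenological model, `T` rounds): the
# space-time decoding problem and the Dennis–Kitaev–Landahl–Preskill counting-bound threshold

Topic `Literature/InformationTheory/QuantumCodes` (venture QEC, LADDER-QEC rung Q5, PARTITION row 09
"phenomenological"; qec-lead ruling 2026-08-26T22:51:09Z "D1": same D4″ architecture as the
perfect-measurement file `ToricCodeThreshold.lean`). Column words: DEFINITION (the space-time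
complex, the observed data, the decoding problem, the failure probability — computable data over
`ZMod 2`), PROVED (the observed syndrome history determines the space-time boundary of the error
history: `stSyn_castSucc`, `stSyn_last`; the isotropic weight `phenomenologicalWeight_self`), and
STATEMENT-ONLY named facts `def … : Prop` (the printed threshold bound in parametric form, to be
discharged as `…_holds`). No numerical threshold is asserted; the printed `p, q < .0114` is a CLAIM
(numerical `μ₃ ≈ 4.684`) recorded in a docstring only.

**The model** (DKLP §4.1–4.2, p. 12 of the held text; §5.1): the `L × L` toric code is monitored for
`T` rounds; in round `t` (`t = 0, …, T-1`) every link first suffers a fresh `Z` error independently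
with probability `p` ("horizontal links", `Edge L × Fin T` — qubit `ℓ` in time slice `t`) and then
every site operator `X_s` is measured, the recorded bit being wrong independently with probability
`q` ("vertical links", `Vertex L × Fin T` — the link joining site `s` in slice `t` to slice `t+1`):
"Errors on horizontal links occur with probability `p`, and errors on vertical links occur with
probability `q`." The location type is the tree's `HistoryLoc (Edge L) (Vertex L) T` and the law
is `phenomenologicalWeight T p q` (`CodeCapacityNoise.lean`). An **error history** is a
`ℤ₂`-valued 1-chain `E : History L T` on these links; the space-time sites are
`STSite L T = Vertex L × Fin (T+1)` (slice `T` is the closing slice, see below).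

**Finite window** (the typed reading of the printed bi-infinite history, §4.3 "repeated rounds of
syndrome measurement extend indefinitely"; §5.2 ¶1 "we may confine our attention to SAW's that lie
between two time slices separated by the finite time `T`", p. 20): the window is closed by ONE
perfect round after round `T-1` (no further errors, exact syndrome), the standard memory
experiment. With this closing round the space-time BOUNDARY `∂E = stMatrix L T *ᵥ E` of the error
history — at the site `(s,t)`: the errors of slice `t` meeting `s` plus the measurement errors on
the two vertical links at `(s,t)` — is EXACTLY the observed data: `∂E (s, t) = S_t(s) + S_{t-1}(s)`
for `t < T` (consecutive noisy outcomes, `S_{-1} := 0`; `stSyn_castSucc`) and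
`∂E (s, T) = S_{T-1}(s) + F(s)` with `F` the perfect final outcome (`stSyn_last`) — PROVED below.
Hence a decoder is a tree `Decoder (STSyndrome L T) (History L T)` fed with `∂E` ("the measured
syndrome `S` reveals the boundary of the error chain `E`", §4.3), and DKLP's estimate `E_min`
("we choose `E_min` to be the chain with `∂E_min = ∂S` that has the minimal value of
`H·log((1-p)/p) + V·log((1-q)/q)`", §5.1 eqs. (E_min), (weight)) is, in the ISOTROPIC case `p = q`
typed here, a minimum-weight decoder for `stSyn` w.r.t. the space-time cycles `stCycles` and the
number of links `hammingNorm` — the tree's `Decoder.IsMinWeight` ("If the minimal chain is not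
unique, one of the minimal chains is selected": every such decoder). **Success** (§4.3 "as long as
the cycle `E + E'` is homologically trivial … recovery will be successful. If `C + C'` is
homologically nontrivial, then recovery will fail"; §6.1 "The chain … can be projected onto the
final time slice"): the residual `Z`-error on the qubits after the correction `E'` is the spatial
PROJECTION `Π(E + E')` (sum of the horizontal slices, `History.proj`; vertical links carry no qubit
error), and recovery succeeds iff it is a product of plaquette operators, `Π(E + E') ∈ boundaries L`
(`stTrivial`). `phenomFailureProb L T D p q` is the total `phenomenologicalWeight` of the histories
on which `D` fails.

**The threshold bound** (§5.2 eqs. (e_ineq), (saw_prob), (saw_L); §5.3 eqs. (saw_d) at `d = 3`,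
(saw_3), (threshold_iso), (fail_iso), (threshold_iso_num)): failure forces `E + E_min` to contain
a homologically non-trivial self-avoiding polygon of the space-time lattice with `H ≥ L` horizontal
links ("At a minimum, the homologically nontrivial (self-avoiding) path must contain at least `L`
horizontal links"), at least half of whose links are faulty, whence
`Prob_fail ≤ L²T Σ_V Σ_{H ≥ L} n_SAP(H,V) (4p̃)^{H/2}(4q̃)^{V/2}`; with `n_SAP^{(3)}(ℓ) ≤ P₃(ℓ)μ₃^ℓ`
this "becomes arbitrarily small as `L` gets large (with `T` increasing no faster than a polynomial
of `L`)" provided `p̃, q̃ < (4μ₃²)⁻¹` — "Eq. (threshold_iso_num) bounds the accuracy threshold in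
the case `p = q`". Typed, as in D4″, in PER-LENGTH EXPONENTIAL FORM on the number `cₙ(ℤ³)` of
`n`-step self-avoiding walks of `ℤ³` taken BY NAME from the tree
(`Literature.Probability.RandomPlanarGeometry.SAW.Zd.count 3`; `SAWCountBound3 C ν : ∀ n, cₙ ≤ C νⁿ`),
for the isotropic rate `p = q` and isotropic minimum-weight decoding: ONE parametric statement
`phenomThreshold_of_sawCountBound` (+ the finite-size form `phenomFailureProb_le_of_sawCountBound`,
eq. (fail_iso) shape with our constant). Its INSTANCES are Summits-side corollaries by import with
tiers: `ν = 5` (`SAW.Zd.count_succ_le` at `d = 3`, eq. (saw_d): `p < (5-2√6)/10 ≈ .0101`, kernel),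
every `ν > 4.76` (`SAW.Zd.connectiveConstant_three_le_476`, `native_decide`: `p < .0111`,
CHECKED-native), every `ν > 4.7387` given the named fact `SAW.Zd.PT2000_connectiveConstant_three_le`
(`p < .0112`, conditional). CLAIM, not typed: the printed "`p̃, q̃ < (87.8)⁻¹ = .0113`, or
`p, q < .0114`" (numerical `μ₃ ≈ 4.684`).

Deliberately NOT here: the proof of the named facts (Q5 item; the 2D proof
`ToricCodeThresholdProof.lean` ports: the isotropic half-weight bound is `PathCountingBound.lean`
verbatim on the link type `STLink L T`); the anisotropic case `p ≠ q` (weighted minimum-weight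
decoding with real weights `log((1-p)/p)`, `log((1-q)/q)` and anisotropic walk counts, §5.4); the
overlapping-recovery method for genuinely finite-time computation (§6.2); planar codes; the 4D code;
any Monte Carlo number (VALIDATED column, `bench/VALIDATED.tsv`).

## References (read)

* [DennisEtAl2002] E. Dennis, A. Kitaev, A. Landahl, J. Preskill, *Topological quantum memory*,
  J. Math. Phys. 43 (2002) 4452–4505, arXiv:quant-ph/0110143 (held `paper:arxiv-quant-ph_0110143`):
  §4.1 (error model: `p`, `q`), §4.2 (defects in spacetime: horizontal / vertical links, `T` time
  slices), §4.3 (`∂(S+E) = 0`; success iff `E + E'` homologically trivial), §5.1 (eqs. (HV_prob),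
  (E_min), (weight)), §5.2 (eqs. (e_ineq), (saw_prob), (saw_L); "at least `L` horizontal links"),
  §5.3 (eqs. (saw_d), (saw_3), (threshold_iso), (fail_iso), (threshold_iso_num): `p, q < .0114`),
  §6.1 (projection `Π` onto the final time slice).
-/

namespace Literature.InformationTheory.QuantumCodes

open Finset Filter Topology Matrix
open Literature.Probability.LatticeModels (TorusSite)
open Literature.Probability.RandomPlanarGeometry

namespace ToricCode

variable (L T : ℕ)

/-! ### The space-time complex of `T` rounds of syndrome measurement -/

/-- The space-time SITES `(s, t)`: site `s` of the toric lattice in time slice `t ∈ {0, …, T}`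
(slices `0, …, T-1` carry the qubit errors of the `T` rounds; slice `T` is the closing slice of the
window). There are `L²(T+1)` of them ("Such an SAW can begin at any one of `L²·T` lattice sites of
our three-dimensional lattice"). [cite: DennisEtAl2002, §4.2 (three-dimensional simple cubic lattice, integer time) and §5.2 (L²T sites)] -/
abbrev STSite : Type := Vertex L × Fin (T + 1)

/-- The space-time LINKS = the fault locations of the phenomenological model (the tree's
`HistoryLoc (Edge L) (Vertex L) T`): horizontal links `Sum.inl (ℓ, t)` — a `Z` error on qubit `ℓ`
in slice `t` (probability `p`) — and vertical links `Sum.inr (s, t)` — a wrong outcome of the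
measurement of `X_s` in round `t`, drawn from `(s,t)` to `(s,t+1)` (probability `q`).
[cite: DennisEtAl2002, §4.2 (horizontal links probability p, vertical links probability q)] -/
abbrev STLink : Type := HistoryLoc (Edge L) (Vertex L) T

/-- An **error history**: a `ℤ₂`-valued 1-chain on the space-time links ("the error chain
containing all links where errors have occurred, including both qubit errors on horizontal links
and measurement errors on vertical links"). [cite: DennisEtAl2002, §4.3 (error chain E)] -/
abbrev History : Type := STLink L T → ZMod 2

/-- `ℤ₂`-valued 0-chains on the space-time sites (space-time syndromes / boundaries).
[cite: DennisEtAl2002, §4.3 (∂S = ∂E)] -/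
abbrev STSyndrome : Type := STSite L T → ZMod 2

variable {L T}

/-- The qubit errors of round `t` (the horizontal links of slice `t`) as a chain of the toric
lattice. [cite: DennisEtAl2002, §4.2 (qubit error at time t ↔ horizontal link in slice t)] -/
def History.slice (E : History L T) (t : Fin T) : Chain L :=
  fun ℓ => E (Sum.inl (ℓ, t))

/-- The measurement errors of round `t` (the vertical links between slices `t` and `t+1`) as a
0-chain on the sites. [cite: DennisEtAl2002, §4.2 (errors in the syndrome measurement ↔ vertical links)] -/
def History.meas (E : History L T) (t : Fin T) : Syndrome L :=
  fun s => E (Sum.inr (s, t))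

/-- The qubit errors accumulated up to and including round `t`: `E_0 + ⋯ + E_t`.
[cite: DennisEtAl2002, §4.2 (error history)] -/
def History.accum (E : History L T) (t : Fin T) : Chain L :=
  ∑ t' ∈ univ.filter (fun t' : Fin T => t' ≤ t), E.slice t'

/-- The **projection onto the final time slice** `Π(E)`: the horizontal links contained in `E` on an
odd number of time slices, i.e. the net `Z` error left on the qubits by the whole history (vertical
links carry no qubit error). [cite: DennisEtAl2002, §6.1 (the projected chain Π)] -/
def History.proj (E : History L T) : Chain L :=
  ∑ t, E.slice t

variable (L T)

/-- The **space-time boundary operator** as a binary matrix (sites × links): the horizontal link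
`(ℓ, t)` is incident to the sites of slice `t` met by `ℓ` (the star incidence `starMatrix L`), the
vertical link `(s, t)` to the two sites `(s, t)` and `(s, t+1)`.
[cite: DennisEtAl2002, §4.2–4.3 (spacetime lattice; ∂)] -/
def stMatrix : Matrix (STSite L T) (STLink L T) (ZMod 2) :=
  Matrix.of fun x ℓ => Sum.elim
    (fun et : Edge L × Fin T => if x.2 = et.2.castSucc then starMatrix L x.1 et.1 else 0)
    (fun vt : Vertex L × Fin T =>
      if x.1 = vt.1 ∧ (x.2 = vt.2.castSucc ∨ x.2 = vt.2.succ) then 1 else 0) ℓ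

/-- The space-time boundary `∂E = stMatrix *ᵥ E` of a history — the decoder's input (it is the
observed syndrome record, `stSyn_castSucc` / `stSyn_last`). [cite: DennisEtAl2002, §4.3 (∂S = ∂E)] -/
def stSyn [NeZero L] (E : History L T) : STSyndrome L T :=
  stMatrix L T *ᵥ E

/-- The space-time CYCLES: histories without boundary (closed defect world lines) = the histories
invisible in the syndrome record = the undetectable set `N` of the decoding problem.
[cite: DennisEtAl2002, §4.3 (C is a cycle; E' = S + C' has the same boundary)] -/
def stCycles [NeZero L] : Set (History L T) :=
  {C | stSyn L T C = 0}

/-- The HARMLESS histories: those whose projection onto the final slice is homologically trivial (a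
sum of plaquette boundaries, `boundaries L`), i.e. whose net effect on the code space is a
stabilizer element. Recovery by `E'` after `E` succeeds iff `E + E'` lies here.
[cite: DennisEtAl2002, §4.3 (success iff E + E' homologically trivial) and §6.1 (Π)] -/
def stTrivial [NeZero L] : Set (History L T) :=
  {C | History.proj C ∈ boundaries L}

/-- A decoder for the `T`-round memory experiment: space-time syndrome record ↦ estimated error
history `E'` (of which only the projection `Π(E')` is applied to the qubits). The results below
assume `Decoder.IsMinWeight D (stSyn L T) (stCycles L T) hammingNorm` — `∂E' = ∂E` and `E'` has the
minimal number of links (DKLP's `E_min` for `p = q`). [cite: DennisEtAl2002, §5.1 eqs. (E_min), (weight)] -/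
abbrev STDecoder : Type := Decoder (STSyndrome L T) (History L T)

/-! ### The observed data and the boundary (PROVED: the record determines `∂E`) -/

variable {L T}

/-- The outcome of round `t` at site `s` as RECORDED: the true syndrome of the accumulated error,
`∂(E_0 + ⋯ + E_t)(s)`, flipped iff the vertical link `(s,t)` carries a measurement error.
[cite: DennisEtAl2002, §4.2 (the measured syndrome is marked on the vertical link; on some of these the measured syndrome is erroneous)] -/
def History.roundSyndrome [NeZero L] (E : History L T) (t : Fin T) : Syndrome L :=
  syn L (E.accum t) + E.meas t

/-- The outcome of the closing PERFECT round: the true syndrome `∂Π(E)` of the net error.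
[cite: DennisEtAl2002, §5.2 ¶1 (finite window between two time slices) with §4.3] -/
def History.finalSyndrome [NeZero L] (E : History L T) : Syndrome L :=
  syn L E.proj

/-- Unfolding the boundary at a site `(s, τ)`: the slice-`τ` errors meeting `s` plus the
measurement errors on the vertical links below and above `(s, τ)`.
[cite: DennisEtAl2002, §4.3 (∂)] -/
theorem stSyn_apply [NeZero L] (E : History L T) (s : Vertex L) (τ : Fin (T + 1)) :
    stSyn L T E (s, τ) =
      (∑ t : Fin T, if τ = t.castSucc then syn L (E.slice t) s else 0) +
        ∑ t : Fin T, if τ = t.castSucc ∨ τ = t.succ then E.meas t s else 0 := by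
  simp only [stSyn, mulVec, dotProduct, stMatrix, of_apply, Fintype.sum_sum_type, Sum.elim_inl,
    Sum.elim_inr]
  congr 1
  · rw [Fintype.sum_prod_type, Finset.sum_comm]
    refine Finset.sum_congr rfl fun t _ => ?_
    by_cases h : τ = t.castSucc
    · simp only [h, if_true, syn, mulVec, dotProduct, History.slice]
    · simp only [h, if_false, zero_mul, Finset.sum_const_zero]
  · rw [Fintype.sum_prod_type, Finset.sum_comm]
    refine Finset.sum_congr rfl fun t _ => ?_
    rw [Finset.sum_eq_single s]
    · by_cases h : τ = t.castSucc ∨ τ = t.succ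
      · simp [h, History.meas]
      · simp [h]
    · intro w _ hw
      simp [Ne.symm hw]
    · intro h; exact absurd (Finset.mem_univ s) h

/-- **The record determines the boundary, interior slices**: at a site of slice `t < T`,
`∂E(s,t)` is the sum of the two consecutive recorded outcomes `S_t(s) + S_{t-1}(s)` (`S_{-1} := 0`)
— the "syndrome changes" a decoder actually sees. [cite: DennisEtAl2002, §4.3 (∂S = ∂E; S + E has no boundary)] -/
theorem stSyn_castSucc [NeZero L] (E : History L T) (s : Vertex L) (t : Fin T) :
    stSyn L T E (s, t.castSucc) =
      E.roundSyndrome t s + if h : 0 < (t : ℕ) then E.roundSyndrome ⟨(t : ℕ) - 1, by omega⟩ s else 0 := by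
  rw [stSyn_apply]
  -- horizontal part: only the slice `t` contributes
  have hhor : (∑ t' : Fin T, if t.castSucc = t'.castSucc then syn L (E.slice t') s else 0) =
      syn L (E.slice t) s := by
    rw [Finset.sum_eq_single t]
    · simp
    · intro t' _ ht'
      rw [if_neg]
      exact fun h => ht' (Fin.castSucc_injective _ h).symm
    · intro h; exact absurd (Finset.mem_univ t) h
  rw [hhor]
  by_cases h0 : 0 < (t : ℕ)
  · -- the previous round `tp = t - 1`
    set tp : Fin T := ⟨(t : ℕ) - 1, by omega⟩ with htp_def
    have htp : (tp : ℕ) = (t : ℕ) - 1 := rfl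
    rw [dif_pos h0]
    have hne : tp ≠ t := fun h => by have hv : (tp : ℕ) = t := congrArg Fin.val h; omega
    -- vertical part: the links `(s,t)` and `(s,tp)`
    have hver : (∑ t' : Fin T, if t.castSucc = t'.castSucc ∨ t.castSucc = t'.succ then E.meas t' s else 0) =
        E.meas t s + E.meas tp s := by
      rw [← Finset.sum_erase_add _ _ (Finset.mem_univ t),
        ← Finset.sum_erase_add _ _ (Finset.mem_erase.2 ⟨hne, Finset.mem_univ _⟩)]
      rw [Finset.sum_eq_zero]
      · simp only [true_or, if_true, zero_add]
        rw [if_pos]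
        · ring
        · exact Or.inr (Fin.ext (show (t : ℕ) = (tp : ℕ) + 1 by omega))
      · intro t' ht'
        rw [Finset.mem_erase, Finset.mem_erase] at ht'
        rw [if_neg]
        rintro (h | h)
        · exact ht'.2.1 (Fin.castSucc_injective _ h).symm
        · have hv : (t : ℕ) = (t' : ℕ) + 1 := congrArg Fin.val h
          exact ht'.1 (Fin.ext (show (t' : ℕ) = tp by omega))
    rw [hver]
    -- the accumulated errors telescope: `accum t = slice t + accum tp`
    have hacc : E.accum t = E.slice t + E.accum tp := by
      simp only [History.accum]
      have hsplit : univ.filter (fun t' : Fin T => t' ≤ t) =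
          insert t (univ.filter fun t' : Fin T => t' ≤ tp) := by
        ext t'
        simp only [Finset.mem_filter, Finset.mem_univ, true_and, Finset.mem_insert, Fin.le_def,
          Fin.ext_iff]
        omega
      rw [hsplit, Finset.sum_insert]
      simp only [Finset.mem_filter, Finset.mem_univ, true_and, Fin.le_def]
      omega
    simp only [History.roundSyndrome, hacc, syn, Matrix.mulVec_add, Pi.add_apply]
    -- in `ℤ₂`: the syndrome of `accum tp` appears twice and cancels
    generalize (starMatrix L *ᵥ E.slice t) s = a
    generalize (starMatrix L *ᵥ E.accum tp) s = b
    generalize E.meas t s = c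
    generalize E.meas tp s = c'
    have h2 : b + b = 0 := by revert b; decide
    linear_combination -h2
  · rw [dif_neg h0, add_zero]
    have hver : (∑ t' : Fin T, if t.castSucc = t'.castSucc ∨ t.castSucc = t'.succ then E.meas t' s else 0) =
        E.meas t s := by
      rw [Finset.sum_eq_single t]
      · simp
      · intro t' _ ht'
        rw [if_neg]
        rintro (h | h)
        · exact ht' (Fin.castSucc_injective _ h).symm
        · have hv : (t : ℕ) = (t' : ℕ) + 1 := congrArg Fin.val h
          omega
      · intro h; exact absurd (Finset.mem_univ t) h
    rw [hver]
    have hacc : E.accum t = E.slice t := by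
      simp only [History.accum]
      have hsingle : univ.filter (fun t' : Fin T => t' ≤ t) = {t} := by
        ext t'
        simp only [Finset.mem_filter, Finset.mem_univ, true_and, Finset.mem_singleton, Fin.le_def,
          Fin.ext_iff]
        omega
      rw [hsingle, Finset.sum_singleton]
    simp only [History.roundSyndrome, hacc, syn, Pi.add_apply]

/-- **The record determines the boundary, closing slice**: at a site of the closing slice `T`,
`∂E(s,T)` is the last recorded outcome plus the perfect final outcome, `S_{T-1}(s) + F(s)` (for
`T = 0` there is no round and the boundary is `0`). [cite: DennisEtAl2002, §4.3 (∂S = ∂E) with §5.2 ¶1 (finite window)] -/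
theorem stSyn_last [NeZero L] (E : History L T) (s : Vertex L) :
    stSyn L T E (s, Fin.last T) =
      if h : 0 < T then E.roundSyndrome ⟨T - 1, by omega⟩ s + E.finalSyndrome s else 0 := by
  rw [stSyn_apply]
  have hhor : (∑ t' : Fin T, if Fin.last T = t'.castSucc then syn L (E.slice t') s else 0) = 0 :=
    Finset.sum_eq_zero fun t' _ => by
      rw [if_neg]; exact fun h => (Fin.castSucc_lt_last t').ne h.symm
  rw [hhor, zero_add]
  by_cases hT : 0 < T
  · rw [dif_pos hT]
    set tl : Fin T := ⟨T - 1, by omega⟩ with htl_def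
    have htl : (tl : ℕ) = T - 1 := rfl
    have hver : (∑ t' : Fin T, if Fin.last T = t'.castSucc ∨ Fin.last T = t'.succ then E.meas t' s else 0) =
        E.meas tl s := by
      rw [Finset.sum_eq_single tl]
      · rw [if_pos]
        exact Or.inr (Fin.ext (show T = (tl : ℕ) + 1 by omega))
      · intro t' _ ht'
        rw [if_neg]
        rintro (h | h)
        · exact (Fin.castSucc_lt_last t').ne h.symm
        · have hv : T = (t' : ℕ) + 1 := congrArg Fin.val h
          exact ht' (Fin.ext (show (t' : ℕ) = tl by omega))
      · intro h; exact absurd (Finset.mem_univ tl) h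
    rw [hver]
    -- `m_{T-1} = S_{T-1} + F` since `accum (T-1) = proj`
    have hacc : E.accum tl = E.proj := by
      simp only [History.accum, History.proj]
      congr 1
      ext t'
      have ht' := t'.isLt
      simp only [Finset.mem_filter, Finset.mem_univ, true_and, Fin.le_def, htl, iff_true]
      omega
    simp only [History.roundSyndrome, History.finalSyndrome, hacc, Pi.add_apply]
    generalize syn L E.proj s = a
    generalize E.meas tl s = c
    have h2 : a + a = 0 := by revert a; decide
    linear_combination -h2
  · rw [dif_neg hT]
    exact Finset.sum_eq_zero fun t' _ => absurd t'.pos (by omega)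

/-! ### The failure probability -/

variable (L T)

open Classical in
/-- **Failure probability** of the decoder `D` in the `T`-round memory experiment on the `L × L`
toric code with qubit-error rate `p` and measurement-error rate `q`: the total probability
(`phenomenologicalWeight`) of the error histories `E` for which the residual error
`Π(E + D(∂E))` is homologically non-trivial. [cite: DennisEtAl2002, §5.2 (Prob_fail) with §5.1 eq. (HV_prob)] -/
noncomputable def phenomFailureProb [NeZero L] (D : STDecoder L T) (p q : ℝ) : ℝ :=
  ∑ E ∈ univ.filter (fun E : History L T => ¬ D.Corrects (stSyn L T) (stTrivial L T) E),
    phenomenologicalWeight T p q (supp E)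

variable {L T}

/-- In the isotropic case `q = p` the phenomenological law is the plain independent bit-flip law of
rate `p` on all space-time links (the tree's `bernoulliWeight`).
[cite: DennisEtAl2002, §5.3 (the case p = q)] -/
theorem phenomenologicalWeight_self {Q C : Type*} [Fintype Q] [Fintype C] [DecidableEq Q]
    [DecidableEq C] (T : ℕ) (p : ℝ) (E : Finset (HistoryLoc Q C T)) :
    phenomenologicalWeight T p p E = bernoulliWeight p E := by
  rw [bernoulliWeight_eq_indepWeight, phenomenologicalWeight]
  congr 1
  funext ℓ
  cases ℓ <;> rfl

/-! ### The counting hypothesis and the printed statements -/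

/-- **Per-length exponential bound on self-avoiding walks of `ℤ³`** (the D4″ hypothesis shape, cubic
case): `cₙ(ℤ³) ≤ C νⁿ` for every `n`, `cₙ(ℤ³) = SAW.Zd.count 3 n` (Literature/Probability/RandomPlanarGeometry,
by name). DKLP's elementary count is the instance `C = 6/5, ν = 5` (`SAW.Zd.count_succ_le`, `d = 3`).
[cite: DennisEtAl2002, §5.3 eqs. (saw_d), (saw_3)] -/
def SAWCountBound3 (C ν : ℝ) : Prop :=
  ∀ n : ℕ, (SAW.Zd.count 3 n : ℝ) ≤ C * ν ^ n

/-- **Polynomially many rounds**: `T(L) ≤ A (L+1)^k` ("with `T` increasing no faster than a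
polynomial of `L`"; DKLP take `T = O(L)`). [cite: DennisEtAl2002, §5.3 (after eq. (fail_iso)) and §5.2 ¶1 (T = O(L))] -/
def IsPolyBounded (T : ℕ → ℕ) : Prop :=
  ∃ (A : ℝ) (k : ℕ), ∀ L : ℕ, (T L : ℝ) ≤ A * ((L : ℝ) + 1) ^ k

/-- **The Dennis–Kitaev–Landahl–Preskill threshold for the toric code with NOISY syndrome
measurement, isotropic case `q = p`, minimum-weight space-time decoding, parametric in the cubic
walk-count bound.** Printed: `Prob_fail ≤ L²T Σ_V Σ_{H ≥ L} n_SAP(H,V)(4p̃)^{H/2}(4q̃)^{V/2}`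
(eq. (saw_L)), and with `n_SAP^{(3)}(ℓ) ≤ P₃(ℓ) μ₃^ℓ`, "Provided that `p̃ < (4μ₃²)⁻¹`,
`q̃ < (4μ₃²)⁻¹` … `Prob_fail < Q₃(L,T)·(4μ₃² p̃)^{L/2}` … it will suffice that `Prob_fail` becomes
arbitrarily small as `L` gets large (with `T` increasing no faster than a polynomial of `L`)";
"Eq. (threshold_iso_num) bounds the accuracy threshold in the case `p = q`". Typed form: for all
`C, ν` with `SAWCountBound3 C ν`, every polynomially bounded schedule of rounds `T(L)`, every
family `D L` of minimum-weight space-time decoders of the `(L+1) × (L+1)` toric codes monitored for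
`T(L)` rounds, and every `0 ≤ p ≤ 1/2` with `4ν² p(1-p) < 1`, the failure probability at
`q = p` tends to `0` as `L → ∞`. (The printed numerical corollary "`p, q < .0114`" uses the
ESTIMATE `μ₃ ≈ 4.684` and is a CLAIM only; certified instances live in
`Summits/Ventures/QEC/Thresholds/`.) STATEMENT ONLY — Q5 proof target.
[cite: DennisEtAl2002, §5.2–5.3 eqs. (saw_L), (threshold_iso), (fail_iso), (threshold_iso_num)] -/
def phenomThreshold_of_sawCountBound : Prop :=
  ∀ (C ν : ℝ), 0 < ν → SAWCountBound3 C ν →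
    ∀ (T : ℕ → ℕ), IsPolyBounded T →
      ∀ (D : (L : ℕ) → STDecoder (L + 1) (T L)),
        (∀ L, (D L).IsMinWeight (stSyn (L + 1) (T L)) (stCycles (L + 1) (T L)) hammingNorm) →
          ∀ p : ℝ, 0 ≤ p → p ≤ 1 / 2 → 4 * ν ^ 2 * (p * (1 - p)) < 1 →
            Tendsto (fun L => phenomFailureProb (L + 1) (T L) (D L) p p) atTop (𝓝 0)

/-- **Finite-size form** (eq. (fail_iso): "`Prob_fail < Q₃(L,T)·(4μ₃² p̃)^{L/2}` where `Q₃(L,T)`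
is a polynomial"): under `SAWCountBound3 C ν`, for `L ≥ 3`, a minimum-weight space-time decoder and
`0 ≤ p ≤ 1/2` with `r := 2ν√(p(1-p)) < 1`,
`Prob_fail ≤ 2 L²(T+1) · C · r^L / (ν(1-r))` — the geometric tail of
`Σ_{ℓ ≥ L} L²(T+1) · c_{ℓ-1}(ℤ³) · (4p̃)^{ℓ/2}` (rooted space-time polygons with `ℓ` links number at
most `L²(T+1) · c_{ℓ-1}`, and a non-trivial one has `ℓ ≥ H ≥ L`). STATEMENT ONLY (the constant is
ours, the shape is printed). [cite: DennisEtAl2002, §5.3 eq. (fail_iso)] -/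
def phenomFailureProb_le_of_sawCountBound : Prop :=
  ∀ (C ν : ℝ), 0 < ν → SAWCountBound3 C ν →
    ∀ (L T : ℕ) [NeZero L], 3 ≤ L → ∀ (D : STDecoder L T),
      D.IsMinWeight (stSyn L T) (stCycles L T) hammingNorm →
        ∀ p : ℝ, 0 ≤ p → p ≤ 1 / 2 → 2 * ν * Real.sqrt (p * (1 - p)) < 1 →
          phenomFailureProb L T D p p ≤
            2 * (L : ℝ) ^ 2 * ((T : ℝ) + 1) * C * (2 * ν * Real.sqrt (p * (1 - p))) ^ L /
              (ν * (1 - 2 * ν * Real.sqrt (p * (1 - p))))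

end ToricCode

end Literature.InformationTheory.QuantumCodes
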